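import Literature.AlgebraicGeometry.Resolution.Lipman1969RationalSurfaceSingularities
import Literature.AlgebraicGeometry.Motives.CartierDivisorCurveDegree
import Literature.AlgebraicGeometry.Motives.CyclesEquivalencesFlatPullbackProofs
import Literature.AlgebraicGeometry.Motives.SubschemeCycles
import Literature.AlgebraicGeometry.Motives.AbelianVarietyTheoremOfCube
import Mathlib.RingTheory.LocalRing.ResidueField.Basic
import HarnessLib

/-!
# The intersection number `(𝒪_X(D) · E)` with an exceptional curve is a degree over the residue field

Topic: `Literature/AlgebraicGeometry/Resolution`. PROVED packaging for the intersection numbers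
`excCurveDegree f D η = (𝒪_X(D) · E_η)` of `Resolution/Lipman1969RationalSurfaceSingularities.lean`
(Lipman 1969, §10 and §12: `(ℒ · C) = deg_C(i^* ℒ)`, the degree of an invertible sheaf on a curve
proper over the local base with zero-dimensional image, computed with lengths over `A`, i.e. over
the residue field `A/𝔪`):

* `base_eq_closedPoint_of_specializes` — the closed fibre of `f : X → Spec A` (`A` local) is stable
  under specialisation;
* `appTop_ΓSpecIso_inv_eq_zero_of_mem_maximalIdeal` — for `E = closure {η}` (reduced) in the closed
  fibre, `A → Γ(E, 𝒪_E)` kills `𝔪`;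
* `exists_fac_specResidueField` — the structure morphism `E → X → Spec A` FACTORS through
  `Spec (A/𝔪) → Spec A`: an integral exceptional curve is a scheme `q : E → Spec κ(𝔪)` over the residue
  FIELD, proper when `f` is (`isProper_of_fac_specResidueField`);
* `excCurveDegree_eq_degree_of_fac` — **`(𝒪_X(D) · E_η) = deg_{κ(𝔪)} (D|_{E_η})`**, the tree's degree of
  a Cartier divisor on a proper curve over a field (`CartierDivisor.degree (Over.mk q)`,
  `Motives/CartierDivisorCurveDegree`, Fulton Def. 1.4) of the restricted divisor `D.pullbackRep E_η.ι`;
  the residue degrees `[κ(y) : κ(𝔪)]` along `E → Spec A` and along `E → Spec κ(𝔪)` agree because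
  `Spec κ(𝔪) → Spec A` is a closed immersion (`residueDegree_comp`,
  `residueDegree_eq_one_of_stalkMap_surjective`).

No new definitions. Through `excCurveDegree_eq_degree_of_fac` the whole calculus of `Motives/CartierDivisorCurveDegree` (additivity,
vanishing on principal divisors when `dim E = 1`, invariance under linear equivalence, positivity on
effective divisors) applies to Lipman's intersection numbers; the first corollaries are recorded.

## References

* J. Lipman, *Rational singularities …*, Publ. Math. IHÉS 36 (1969), §10 (pp. 212–215), §12
  (p. 220). [Lipman1969]
* W. Fulton, *Intersection Theory*, 2nd ed. (1998), Def. 1.4, Def. 2.3. [Fulton1998]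
-/

noncomputable section

open CategoryTheory AlgebraicGeometry TopologicalSpace IsLocalRing Opposite
open Literature.AlgebraicGeometry.Motives

universe u

namespace Literature.AlgebraicGeometry.Resolution

section ClosedFibreCurve

variable {T : Type u} [CommRing T] [IsLocalRing T] {X : Scheme.{u}} (π : X ⟶ Spec (.of T))

/-- The closed fibre of `π : X → Spec T` (`T` local) is stable under specialisation: a point
specialising from a point over `𝔪` lies over `𝔪` (the closed point of `Spec T` is closed).
[cite: Lipman1969, Section 12 (p. 220)] -/
theorem base_eq_closedPoint_of_specializes {η x : X} (hη : π η = closedPoint T) (h : η ⤳ x) :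
    π x = closedPoint T := by
  have h' : π η ⤳ π x := h.map π.continuous
  rw [hη] at h'
  have hc : IsClosed ({closedPoint T} : Set (PrimeSpectrum T)) :=
    (PrimeSpectrum.isClosed_singleton_iff_isMaximal _).mpr (IsLocalRing.maximalIdeal.isMaximal T)
  exact Set.mem_singleton_iff.mp (h'.mem_closed hc (Set.mem_singleton _))

/-- **`𝔪` dies on an integral exceptional curve**: if `η` lies over the closed point then every
`a ∈ 𝔪` maps to `0` under the structure ring map `T → Γ(E_η, 𝒪_{E_η})` of `E_η = closure {η}`
(`ClosedSubvariety.ofPoint X η`) — its non-vanishing locus on the reduced scheme `E_η` is empty, every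
point of `E_η` lying over `𝔪`. [cite: Lipman1969, Section 12 (p. 220)] -/
theorem appTop_ΓSpecIso_inv_eq_zero_of_mem_maximalIdeal {η : X} (hη : π η = closedPoint T) {a : T}
    (ha : a ∈ maximalIdeal T) :
    ((ClosedSubvariety.ofPoint X η).ι ≫ π).appTop ((Scheme.ΓSpecIso (.of T)).inv a) = 0 := by
  set E := ClosedSubvariety.ofPoint X η with hE
  have key : E.carrier.basicOpen ((E.ι ≫ π).appTop ((Scheme.ΓSpecIso (.of T)).inv a)) = ⊥ := by
    rw [← Scheme.preimage_basicOpen_top, basicOpen_eq_of_affine]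
    ext e
    simp only [TopologicalSpace.Opens.coe_bot, Set.mem_empty_iff_false, iff_false]
    intro he
    have hx : π (E.ι e) = closedPoint T :=
      base_eq_closedPoint_of_specializes π hη (ClosedSubvariety.specializes_ofPoint_ι η e)
    have he' : (E.ι ≫ π) e ∈ PrimeSpectrum.basicOpen a := he
    rw [Scheme.Hom.comp_apply, hx] at he'
    exact ((PrimeSpectrum.mem_basicOpen a (closedPoint T)).mp he') ha
  exact (basicOpen_eq_bot_iff _).mp key

/-- **An integral exceptional curve is a scheme over the residue field**: for `η` over the closed
point, the structure morphism `E_η → X → Spec T` of `E_η = closure {η}` FACTORS through the closed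
immersion `Spec κ(𝔪) → Spec T`, `κ(𝔪) = T/𝔪` (`IsLocalRing.ResidueField`): the ring map
`T → Γ(E_η, 𝒪)` kills `𝔪` and descends to `κ(𝔪)`, and `E_η → Spec Γ(E_η, 𝒪) → Spec κ(𝔪)` is the
factorisation (Γ–Spec adjunction). [cite: Lipman1969, Section 10 (p. 212) and Section 12 (p. 220)] -/
theorem exists_fac_specResidueField {η : X} (hη : π η = closedPoint T) :
    ∃ q : (ClosedSubvariety.ofPoint X η).carrier ⟶ Spec (.of (ResidueField T)),
      q ≫ Spec.map (CommRingCat.ofHom (residue T)) = (ClosedSubvariety.ofPoint X η).ι ≫ π := by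
  set E := ClosedSubvariety.ofPoint X η with hE
  let φ : CommRingCat.of T ⟶ Γ(E.carrier, ⊤) := (Scheme.ΓSpecIso (.of T)).inv ≫ (E.ι ≫ π).appTop
  have hφ : ∀ a ∈ maximalIdeal T, φ a = 0 := fun a ha =>
    appTop_ΓSpecIso_inv_eq_zero_of_mem_maximalIdeal π hη ha
  let ψ : CommRingCat.of (ResidueField T) ⟶ Γ(E.carrier, ⊤) :=
    CommRingCat.ofHom (Ideal.Quotient.lift (maximalIdeal T) φ.hom hφ)
  have hψ : CommRingCat.ofHom (residue T) ≫ ψ = φ := by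
    ext a
    rfl
  refine ⟨E.carrier.toSpecΓ ≫ Spec.map ψ, ?_⟩
  rw [Category.assoc, ← Spec.map_comp, hψ, Spec.map_comp, ← Category.assoc,
    ← Scheme.toSpecΓ_naturality, Category.assoc, toSpecΓ_SpecMap_ΓSpecIso_inv, Category.comp_id]

/-- Through a factorisation `E_η → Spec κ(𝔪) → Spec T`, the structure morphism `q : E_η → Spec κ(𝔪)`
is proper when `π` is (`E_η → X` is a closed immersion, `Spec κ(𝔪) → Spec T` is separated).
[cite: Lipman1969, Section 10 (p. 212)] -/
theorem isProper_of_fac_specResidueField [IsProper π] {η : X}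
    {q : (ClosedSubvariety.ofPoint X η).carrier ⟶ Spec (.of (ResidueField T))}
    (hq : q ≫ Spec.map (CommRingCat.ofHom (residue T)) = (ClosedSubvariety.ofPoint X η).ι ≫ π) :
    IsProper q := by
  have h : IsProper (q ≫ Spec.map (CommRingCat.ofHom (residue T))) := by
    rw [hq]
    infer_instance
  exact IsProper.of_comp q (Spec.map (CommRingCat.ofHom (residue T)))

/-- Residue degrees of points of `E_η` relative to `E_η → Spec T` and to a factorisation
`q : E_η → Spec κ(𝔪)` agree (`Spec κ(𝔪) → Spec T` is a closed immersion, of residue degree `1`).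
[cite: Lipman1969, Section 10 (p. 212)] -/
theorem residueDegree_ι_comp_eq_of_fac {η : X}
    {q : (ClosedSubvariety.ofPoint X η).carrier ⟶ Spec (.of (ResidueField T))}
    (hq : q ≫ Spec.map (CommRingCat.ofHom (residue T)) = (ClosedSubvariety.ofPoint X η).ι ≫ π)
    (y : (ClosedSubvariety.ofPoint X η).carrier) :
    ((ClosedSubvariety.ofPoint X η).ι ≫ π).residueDegree y = q.residueDegree y := by
  rw [← hq, residueDegree_comp]
  have h1 : (Spec.map (CommRingCat.ofHom (residue T))).residueDegree (q.base y) = 1 := by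
    haveI : IsClosedImmersion (Spec.map (CommRingCat.ofHom (residue T))) :=
      IsClosedImmersion.spec_of_surjective _ (residue_surjective (R := T))
    exact residueDegree_eq_one_of_stalkMap_surjective _ _
      ((Spec.map (CommRingCat.ofHom (residue T))).stalkMap_surjective _)
  rw [h1, mul_one]

/-- **`(𝒪_X(D) · E_η)` is the `κ(𝔪)`-degree of `D|_{E_η}`**: for `π : X → Spec T` proper (`T` local,
`X` integral and locally Noetherian), `η` over the closed point, a factorisation
`q : E_η → Spec κ(𝔪)` of the structure morphism (`exists_fac_specResidueField`) and `D` a Cartier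
divisor on `X`: `excCurveDegree π D η = CartierDivisor.degree (Over.mk q) (D.pullbackRep E_η.ι)` —
Lipman's `(ℒ·E) = deg_E(i^*ℒ)` with the degree on the proper `κ(𝔪)`-curve `E` in the form of
Fulton, Def. 1.4 (`Σ_y ord_y · [κ(y) : κ(𝔪)]`, the tree's `CartierDivisor.degree`,
`Motives/CartierDivisorCurveDegree`). [cite: Lipman1969, Section 12 (p. 220) with Section 10 (p. 212)] -/
theorem excCurveDegree_eq_degree_of_fac [IsIntegral X] [IsLocallyNoetherian X] [IsProper π] {η : X}
    {q : (ClosedSubvariety.ofPoint X η).carrier ⟶ Spec (.of (ResidueField T))}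
    (hq : q ≫ Spec.map (CommRingCat.ofHom (residue T)) = (ClosedSubvariety.ofPoint X η).ι ≫ π)
    [IsIntegral (Over.mk q : SchemeOver (ResidueField T)).left]
    [IsProper (Over.mk q : SchemeOver (ResidueField T)).hom] (D : CartierDivisor X) :
    excCurveDegree π D η =
      CartierDivisor.degree (Over.mk q) (D.pullbackRep (ClosedSubvariety.ofPoint X η).ι) := by
  rw [CartierDivisor.degree_eq_finsum]
  unfold excCurveDegree
  refine finsum_congr fun y => ?_
  rw [residueDegree_ι_comp_eq_of_fac π hq y]
  rfl

end ClosedFibreCurve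

/-! ## The calculus of intersection numbers with an integral exceptional curve -/

section Calculus

variable {T : Type u} [CommRing T] [IsLocalRing T] {X : Scheme.{u}} [IsIntegral X]
  [IsLocallyNoetherian X] (π : X ⟶ Spec (.of T)) [IsProper π]

omit [IsIntegral X] [IsLocallyNoetherian X] [IsProper π] in
/-- An integral exceptional curve `E_η` (`η ∈ excCurvePoints π`) is one-dimensional: the generic
point of `E_η` has height `1`. [cite: Lipman1969, Section 10 (p. 212)] -/
theorem height_top_ofPoint_eq_one {η : X} (hη : η ∈ excCurvePoints π) :
    Order.height (⊤ : ↥(ClosedSubvariety.ofPoint X η).carrier) = 1 := by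
  rw [height_top_ofPoint]
  exact hη.2

/-- **Linearly equivalent divisors have the same intersection number with an exceptional curve**
(`𝒪_X(D) ≅ 𝒪_X(D')`; the degree on the proper curve `E_η` is a class invariant, Stacks 02RU).
[cite: Lipman1969, Section 10, Prop. (10.2) (p. 214)] -/
theorem excCurveDegree_congr_linEquiv {η : X} (hη : η ∈ excCurvePoints π) {D D' : CartierDivisor X}
    (H : D.LinEquiv D') : excCurveDegree π D η = excCurveDegree π D' η := by
  obtain ⟨q, hq⟩ := exists_fac_specResidueField π hη.1
  haveI : IsIntegral (Over.mk q : SchemeOver (ResidueField T)).left :=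
    inferInstanceAs (IsIntegral (ClosedSubvariety.ofPoint X η).carrier)
  haveI : IsProper (Over.mk q : SchemeOver (ResidueField T)).hom :=
    isProper_of_fac_specResidueField π hq
  rw [excCurveDegree_eq_degree_of_fac π hq, excCurveDegree_eq_degree_of_fac π hq]
  exact CartierDivisor.LinEquiv.degree_eq (C := Over.mk q) (height_top_ofPoint_eq_one π hη)
    (H.pullbackRep (ClosedSubvariety.ofPoint X η).ι)

/-- **Additivity**: `(𝒪_X(D + D') · E_η) = (𝒪_X(D) · E_η) + (𝒪_X(D') · E_η)`
(Lipman 1969, Remark 2 b) after (12.1): "`((ℒ ⊗ 𝒩)·C) = (ℒ·C) + (𝒩·C)`", from the additivity of the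
degree, Prop. (10.2) a)). [cite: Lipman1969, Section 12, Remark 2 b) (p. 221)] -/
theorem excCurveDegree_add {η : X} (hη : η ∈ excCurvePoints π) (D D' : CartierDivisor X) :
    excCurveDegree π (D + D') η = excCurveDegree π D η + excCurveDegree π D' η := by
  obtain ⟨q, hq⟩ := exists_fac_specResidueField π hη.1
  haveI : IsIntegral (Over.mk q : SchemeOver (ResidueField T)).left :=
    inferInstanceAs (IsIntegral (ClosedSubvariety.ofPoint X η).carrier)
  haveI : IsProper (Over.mk q : SchemeOver (ResidueField T)).hom :=
    isProper_of_fac_specResidueField π hq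
  rw [excCurveDegree_eq_degree_of_fac π hq, excCurveDegree_eq_degree_of_fac π hq,
    excCurveDegree_eq_degree_of_fac π hq]
  set g := (ClosedSubvariety.ofPoint X η).ι
  have hC := height_top_ofPoint_eq_one π hη
  have h1 : ((D + D').pullbackRep g).LinEquiv (D.pullbackRep g + D'.pullbackRep g) :=
    (((D + D').classPullback_linEquiv_pullbackRep g).symm.trans
      (CartierDivisor.classPullback_add_linEquiv g D D')).trans
      ((D.classPullback_linEquiv_pullbackRep g).add (D'.classPullback_linEquiv_pullbackRep g))
  exact (CartierDivisor.LinEquiv.degree_eq (C := Over.mk q) hC h1).trans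
    (CartierDivisor.degree_add _ _ _)

/-- The zero divisor meets every exceptional curve with degree `0`. [cite: Lipman1969, Section 12, Remark 2 b) (p. 221)] -/
theorem excCurveDegree_zero {η : X} (hη : η ∈ excCurvePoints π) :
    excCurveDegree π (0 : CartierDivisor X) η = 0 := by
  have h := excCurveDegree_add π hη 0 0
  have h0 : excCurveDegree π ((0 : CartierDivisor X) + 0) η = excCurveDegree π 0 η :=
    excCurveDegree_congr_linEquiv π hη
      (CartierDivisor.SameDivisor.linEquiv fun i j x _ _ => by
        change RatFn.IsUnitAt x ((1 : X.functionField) * 1 / 1)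
        rw [mul_one, div_one]
        exact RatFn.isUnitAt_one)
  omega

/-- **A principal divisor meets every integral exceptional curve with degree `0`**
(`(𝒪_X·E) = 0`: `div(g)` is linearly equivalent to `0`; Lipman 1969 (12.1) (i), trivial direction).
[cite: Lipman1969, Theorem (12.1) (i) (p. 220)] -/
theorem excCurveDegree_principal {η : X} (hη : η ∈ excCurvePoints π) {h : X.functionField}
    (hh : h ≠ 0) : excCurveDegree π (CartierDivisor.principal h hh) η = 0 := by
  rw [excCurveDegree_congr_linEquiv π hη (CartierDivisor.principal_linEquiv_zero hh)]
  exact excCurveDegree_zero π hη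

/-- `(𝒪_X(-D) · E_η) = -(𝒪_X(D) · E_η)`. [cite: Lipman1969, Section 12, Remark 2 b) (p. 221)] -/
theorem excCurveDegree_neg {η : X} (hη : η ∈ excCurvePoints π) (D : CartierDivisor X) :
    excCurveDegree π (-D) η = - excCurveDegree π D η := by
  have h := excCurveDegree_add π hη D (-D)
  rw [excCurveDegree_congr_linEquiv π hη (D.add_neg_sameDivisor).linEquiv,
    excCurveDegree_zero π hη] at h
  omega

/-- `(𝒪_X(n • D) · E_η) = n · (𝒪_X(D) · E_η)`. [cite: Lipman1969, Section 12, Remark 2 b) (p. 221)] -/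
theorem excCurveDegree_smul {η : X} (hη : η ∈ excCurvePoints π) (D : CartierDivisor X) (n : ℕ) :
    excCurveDegree π (n • D) η = n * excCurveDegree π D η := by
  induction n with
  | zero =>
    rw [Nat.cast_zero, zero_mul,
      excCurveDegree_congr_linEquiv π hη (D.zero_smul_sameDivisor).linEquiv]
    exact excCurveDegree_zero π hη
  | succ n ih =>
    rw [excCurveDegree_congr_linEquiv π hη (D.add_smul_sameDivisor n 1).linEquiv,
      excCurveDegree_add π hη, ih, CartierDivisor.one_smul]
    push_cast
    ring

/-- **An effective divisor not containing `E_η` meets it non-negatively**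
(`(𝒪_X(𝒟)·C) = h⁰(𝒪_{𝒟_C}) ≥ 0` for `𝒟` effective with support not containing `C`; Lipman 1969,
Remark 2 c) after (12.1)). [cite: Lipman1969, Section 12, Remark 2 c) (p. 221)] -/
theorem excCurveDegree_nonneg_of_isEffective {η : X} (hη : η ∈ excCurvePoints π)
    {D : CartierDivisor X} (hD : D.IsEffective) (hDη : D.Avoids η) :
    0 ≤ excCurveDegree π D η := by
  obtain ⟨q, hq⟩ := exists_fac_specResidueField π hη.1
  haveI : IsIntegral (Over.mk q : SchemeOver (ResidueField T)).left :=
    inferInstanceAs (IsIntegral (ClosedSubvariety.ofPoint X η).carrier)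
  haveI : IsProper (Over.mk q : SchemeOver (ResidueField T)).hom :=
    isProper_of_fac_specResidueField π hq
  rw [excCurveDegree_eq_degree_of_fac π hq]
  have hav : D.Avoids ((ClosedSubvariety.ofPoint X η).ι
      (genericPoint (ClosedSubvariety.ofPoint X η).carrier)) := by
    have hgen := ClosedSubvariety.genericPoint_ofPoint (X := X) η
    unfold ClosedSubvariety.genericPoint at hgen
    rw [hgen]
    exact hDη
  exact CartierDivisor.IsEffective.degree_nonneg (C := Over.mk q) (hD.pullbackRep _ hav)

end Calculus

end Literature.AlgebraicGeometry.Resolution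

end
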